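import Summits.QuantumAdvantage.AdviceFreeQNC0.TensorBlocks
import HarnessLib

/-!
# Cell qa-qnc0 (rung F-Q1, density axis, crux of record `TensorMultOneAt` = MULT₁): the MASS-INEQUALITY line —
# statements (Sketch13 v6 VERBATIM), the LIGHT-DEVIATION lemma and the coset invariance of the mass bracket

Planner qa-qnc0-p1 gen 13 (`HOME/qa-qnc0-p1/ROUND-12.md` §2.10 (xi-f)–(xi-l), `Sketch13.lean` v6 §MassInequality).
Level 2 of the tensor tower in DUAL NORMAL FORM: a 2-block strategy is a column map `v ↦ P_v ∈ C_m` (the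
single-block eliminator code, `IsElim1 m`), answered optimally by the other player; its cost is
`Σ_u d(𝟙 + row_u P, C_m)`.  Writing `P_v = K0 + D_v` with `K0` an optimal codeword (zero set `Z`, `|Z| = w(m,1)`):
`cost ≥ w² + bracket(D)`, `bracket(D) = Σ_{u∉Z} d(δ_u, C_m) − Σ_{u∈Z} d(δ_u, C_m)` over the rows `δ_u` of `D`
(triangle inequality).  The planner's conjecture of record for level 2 is the MASS INEQUALITY `bracket ≥ 0`
(`MassIneqAt`); this file lands its statements and the first PROVED piece beyond LP:

* the §MassInequality `def`s of Sketch13 v6 VERBATIM (`pwt`, `pdist`, `IsElim1`, `distC`, `IsOpt1`, `IsSymPat`,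
  `SC1At`, `SC1Sym`, `SC1Eight`/`SC1Fourteen`/`SC1Fifteen`, `ColsInC`, `bracket`, `MassIneqAt`, `MassIneq`,
  `MassIneqPays`, `MultTwoAt`, `MultTwoEight`, `RowLight`, `LightMass`, `BracketShift`) — in the sub-namespace
  `MassInequality` because the tree already has a `pdist` on bit-vectors (`WalkCharacters.lean`); nothing else renamed;
* **`MassInequality.lightMass : ∀ m, LightMass m`** — the LIGHT-DEVIATION / cut-cone lemma (ROUND-12 §2.10 (xi-l)):
  if every row of the deviation `D` is lighter than half of every non-zero codeword, the nearest codeword to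
  each row is `0` (`distC_eq_pwt_of_light`), the bracket double-counts to `Σ_v (|A_v ∖ Z| − |A_v ∩ Z|)` over the
  columns `A_v ∈ C_m`, and support concentration `SC1At m K0` makes every term `≥ 0`: THE PRODUCT IS OPTIMAL
  AGAINST EVERY LIGHT DEVIATION;
* **`MassInequality.bracketShift : ∀ m, BracketShift m`** — the bracket is invariant under adding a matrix whose rows
  lie in `C_m` (`distC` is a coset function: `IsElim1` is closed under `xor`, `isElim1_xor`), so "light" may be
  read modulo `C ⊗ C`.

WHAT THIS IS NOT: `MassIneqAt` / `MassIneq` / `SC1Sym` (finite checks) / `MassIneqPays` are NOT proved here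
(statements only); MULT₁ is OPEN; nothing on crux α; separation NOT moved.
-/

noncomputable section

namespace Summit.QuantumAdvantage.AdviceFreeQNC0

open Finset
open Literature.Computability.MetaComplexity Literature.Computability.MetaComplexity.Smolensky

namespace MassInequality

/-! ### Sketch13 v6 §MassInequality — statements VERBATIM -/

/-- Hamming weight of a PATTERN on the `m`-cube.  (Sketch13 v6, verbatim.) -/
def pwt {m : ℕ} (X : (Fin m → Bool) → Bool) : ℕ :=
  (univ.filter fun u : Fin m → Bool => X u = true).card

/-- Hamming distance of two patterns.  (Sketch13 v6, verbatim; namespaced because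
`Summit.QuantumAdvantage.AdviceFreeQNC0.pdist` on bit-vectors exists in `WalkCharacters.lean`.) -/
def pdist {m : ℕ} (X Y : (Fin m → Bool) → Bool) : ℕ :=
  (univ.filter fun u : Fin m → Bool => X u ≠ Y u).card

/-- The single-block ELIMINATOR CODE `C_m` at block degree 1: `X(u) = T_{|u| mod 3}(u)` for an even triple
of affine `T_r` (`= IsBlockElim m 1 0 1` up to the `Fin (m*1)` bookkeeping). Contains `0`, closed under `xor`.
(Sketch13 v6, verbatim.) -/
def IsElim1 (m : ℕ) (X : (Fin m → Bool) → Bool) : Prop :=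
  ∃ T : ℕ → (Fin m → Bool) → Bool,
    (∀ r, HasDeg (T r) 1) ∧ (∀ u, xor (T 0 u) (xor (T 1 u) (T 2 u)) = false) ∧
    ∀ u, X u = T (wt u % 3) u

/-- Distance of a pattern to the code `C_m` (an `iInf` over the — nonempty — subtype of codewords).
(Sketch13 v6, verbatim.) -/
noncomputable def distC (m : ℕ) (r : (Fin m → Bool) → Bool) : ℕ :=
  ⨅ Q : {Q : (Fin m → Bool) → Bool // IsElim1 m Q}, pdist r Q.1

/-- `K0` is an OPTIMAL codeword: fewest zeros (`failCount K0 = w(m,1) = d(𝟙, C_m)`; 45 at m = 8).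
(Sketch13 v6, verbatim.) -/
def IsOpt1 (m : ℕ) (K0 : (Fin m → Bool) → Bool) : Prop :=
  IsElim1 m K0 ∧ ∀ X, IsElim1 m X → failCount K0 ≤ failCount X

/-- `K0` is symmetric: its value depends on `|u|` only.  (Sketch13 v6, verbatim.) -/
def IsSymPat {m : ℕ} (K0 : (Fin m → Bool) → Bool) : Prop :=
  ∀ u v : Fin m → Bool, wt u = wt v → K0 u = K0 v

/-- SUPPORT CONCENTRATION SC₁ at `K0`: every codeword has at most half of its support inside `Z(K0)`.
(Sketch13 v6, verbatim.) -/
def SC1At (m : ℕ) (K0 : (Fin m → Bool) → Bool) : Prop :=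
  ∀ A, IsElim1 m A →
    (univ.filter fun u : Fin m → Bool => A u = true ∧ K0 u = false).card ≤
      (univ.filter fun u : Fin m → Bool => A u = true ∧ K0 u = true).card

/-- SC₁ at every optimal symmetric codeword (verified m = 7..16 by orbit counting; a finite identity
between binomial sums — provable now at each fixed m, S/M).  (Sketch13 v6, verbatim.) -/
def SC1Sym (m : ℕ) : Prop := ∀ K0, IsOpt1 m K0 → IsSymPat K0 → SC1At m K0

/-- Rung (Sketch13 v6, verbatim). -/
def SC1Eight : Prop := SC1Sym 8
/-- Rung (Sketch13 v6, verbatim). -/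
def SC1Fourteen : Prop := SC1Sym 14
/-- Rung (Sketch13 v6, verbatim). -/
def SC1Fifteen : Prop := SC1Sym 15

/-- All columns of a deviation matrix `D u v` (row `u`, column/context `v`) lie in `C_m`.  (Verbatim.) -/
def ColsInC (m : ℕ) (D : (Fin m → Bool) → (Fin m → Bool) → Bool) : Prop :=
  ∀ v, IsElim1 m (fun u => D u v)

/-- The level-2 MASS BRACKET: outside mass minus inside mass of the rows `δ_u = D u`.  (Verbatim.) -/
noncomputable def bracket (m : ℕ) (K0 : (Fin m → Bool) → Bool)
    (D : (Fin m → Bool) → (Fin m → Bool) → Bool) : ℤ :=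
  (∑ u ∈ univ.filter (fun u : Fin m → Bool => K0 u = true), (distC m (D u) : ℤ)) -
    ∑ u ∈ univ.filter (fun u : Fin m → Bool => K0 u = false), (distC m (D u) : ℤ)

/-- **MI(m) at `K0`** — the mass inequality (CONJECTURE of record for level 2).  (Verbatim.) -/
def MassIneqAt (m : ℕ) (K0 : (Fin m → Bool) → Bool) : Prop :=
  ∀ D, ColsInC m D → 0 ≤ bracket m K0 D

/-- MI(m): the mass inequality at every optimal symmetric codeword.  (Verbatim.) -/
def MassIneq (m : ℕ) : Prop := ∀ K0, IsOpt1 m K0 → IsSymPat K0 → MassIneqAt m K0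

/-- EXACT ACCOUNTING (provable now, M): MI at an optimal `K0` forces `W₂(m,1) ≥ (failCount K0)²`.  (Verbatim.) -/
def MassIneqPays (m : ℕ) : Prop :=
  ∀ K0, IsOpt1 m K0 → MassIneqAt m K0 →
    ∀ win : (Fin (m * 2) → Bool) → Bool, SumCodeWin (m * 2) 2 1 win → failCount K0 ^ 2 ≤ failCount win

/-- Level-2 multiplicativity as a number: `W₂(m,1) ≥ w²`.  (Verbatim.) -/
def MultTwoAt (m w : ℕ) : Prop :=
  ∀ win : (Fin (m * 2) → Bool) → Bool, SumCodeWin (m * 2) 2 1 win → w ^ 2 ≤ failCount win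

/-- Rung/conjecture: `W₂(8,1) = 2025`.  (Verbatim.) -/
def MultTwoEight : Prop := MultTwoAt 8 45

/-- ROW-LIGHTNESS: every row of `D` has weight below half the weight of every non-zero codeword.  (Verbatim.) -/
def RowLight (m : ℕ) (D : (Fin m → Bool) → (Fin m → Bool) → Bool) : Prop :=
  ∀ u, ∀ Q, IsElim1 m Q → pwt Q ≠ 0 → 2 * pwt (D u) < pwt Q

/-- **LIGHT-DEVIATION LEMMA** (cut-cone regime; provable now, S): SC₁ ⇒ the bracket of a row-light
deviation is `≥ 0`.  (Verbatim; proved below as `lightMass`.) -/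
def LightMass (m : ℕ) : Prop :=
  ∀ K0, SC1At m K0 → ∀ D, ColsInC m D → RowLight m D → 0 ≤ bracket m K0 D

/-- Invariance of the bracket under `C ⊗ C` shifts (`E` with rows AND columns in `C_m`); provable now (S).
(Verbatim; proved below as `bracketShift` — the column hypothesis is not even needed.) -/
def BracketShift (m : ℕ) : Prop :=
  ∀ K0 D E, ColsInC m E → (∀ u, IsElim1 m (E u)) →
    bracket m K0 (fun u v => xor (D u v) (E u v)) = bracket m K0 D

/-! ### The code `C_m`: zero and `xor` -/

variable {m : ℕ}

/-- `0 ∈ C_m`. -/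
theorem isElim1_false (m : ℕ) : IsElim1 m (fun _ => false) :=
  ⟨fun _ _ => false, fun _ => hasDeg_false 1, fun _ => by simp, fun _ => rfl⟩

/-- `C_m` is closed under `xor`. -/
theorem isElim1_xor {X Y : (Fin m → Bool) → Bool} (hX : IsElim1 m X) (hY : IsElim1 m Y) :
    IsElim1 m (fun u => xor (X u) (Y u)) := by
  obtain ⟨S, hS, hSx, hSX⟩ := hX
  obtain ⟨T, hT, hTx, hTY⟩ := hY
  refine ⟨fun r u => xor (S r u) (T r u), fun r => hasDeg_xor (hS r) (hT r), fun u => ?_, fun u => ?_⟩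
  · have h1 := hSx u
    have h2 := hTx u
    show xor (xor (S 0 u) (T 0 u)) (xor (xor (S 1 u) (T 1 u)) (xor (S 2 u) (T 2 u))) = false
    revert h1 h2
    cases S 0 u <;> cases S 1 u <;> cases S 2 u <;> cases T 0 u <;> cases T 1 u <;> cases T 2 u <;> decide
  · show xor (X u) (Y u) = xor (S (wt u % 3) u) (T (wt u % 3) u)
    rw [hSX u, hTY u]

/-! ### Distances -/

/-- `pdist r 0 = pwt r`. -/
theorem pdist_false (r : (Fin m → Bool) → Bool) : pdist r (fun _ => false) = pwt r := by
  unfold pdist pwt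
  congr 1
  ext u
  simp

/-- Triangle: `pwt Q ≤ pwt r + pdist r Q`. -/
theorem pwt_le_pwt_add_pdist (r Q : (Fin m → Bool) → Bool) : pwt Q ≤ pwt r + pdist r Q := by
  classical
  unfold pwt pdist
  calc (univ.filter fun u : Fin m → Bool => Q u = true).card
      ≤ ((univ.filter fun u : Fin m → Bool => r u = true) ∪
          (univ.filter fun u : Fin m → Bool => r u ≠ Q u)).card := by
        refine card_le_card fun u hu => ?_
        simp only [mem_filter, mem_univ, true_and, mem_union] at hu ⊢
        cases hr : r u
        · right; rw [hu]; exact Bool.false_ne_true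
        · left; rfl
    _ ≤ _ := card_union_le _ _

/-- `pdist` is symmetric under a common `xor` shift: `pdist (r ⊕ e) Q = pdist r (Q ⊕ e)`. -/
theorem pdist_xor (r e Q : (Fin m → Bool) → Bool) :
    pdist (fun v => xor (r v) (e v)) Q = pdist r (fun v => xor (Q v) (e v)) := by
  unfold pdist
  congr 1
  ext v
  simp only [mem_filter, mem_univ, true_and]
  cases r v <;> cases e v <;> cases Q v <;> decide

/-- `distC m r ≤ pdist r Q` for every codeword `Q`. -/
theorem distC_le {r Q : (Fin m → Bool) → Bool} (hQ : IsElim1 m Q) : distC m r ≤ pdist r Q :=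
  ciInf_le' (fun Q : {Q : (Fin m → Bool) → Bool // IsElim1 m Q} => pdist r Q.1) ⟨Q, hQ⟩

/-- A uniform lower bound on the distances to codewords bounds `distC` from below. -/
theorem le_distC {r : (Fin m → Bool) → Bool} {b : ℕ} (h : ∀ Q, IsElim1 m Q → b ≤ pdist r Q) :
    b ≤ distC m r := by
  haveI : Nonempty {Q : (Fin m → Bool) → Bool // IsElim1 m Q} := ⟨⟨_, isElim1_false m⟩⟩
  exact le_ciInf fun Q => h Q.1 Q.2

/-- `distC m r ≤ pwt r` (the zero codeword). -/
theorem distC_le_pwt (r : (Fin m → Bool) → Bool) : distC m r ≤ pwt r := by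
  rw [← pdist_false r]; exact distC_le (isElim1_false m)

/-- In the unique-decoding regime the nearest codeword is `0`: if `2·pwt r < pwt Q` for every non-zero
codeword `Q`, then `distC m r = pwt r`. -/
theorem distC_eq_pwt_of_light {r : (Fin m → Bool) → Bool}
    (hlight : ∀ Q, IsElim1 m Q → pwt Q ≠ 0 → 2 * pwt r < pwt Q) : distC m r = pwt r := by
  refine le_antisymm (distC_le_pwt r) (le_distC fun Q hQ => ?_)
  by_cases h0 : pwt Q = 0
  · -- `Q` is the zero pattern
    have hQ0 : Q = fun _ => false := by
      funext u
      unfold pwt at h0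
      rw [Finset.card_eq_zero, filter_eq_empty_iff] at h0
      have := h0 (mem_univ u)
      cases hq : Q u
      · rfl
      · exact absurd hq this
    rw [hQ0, pdist_false]
  · have h1 := hlight Q hQ h0
    have h2 := pwt_le_pwt_add_pdist r Q
    omega

/-- `distC` is a coset function: adding a codeword to the pattern does not change it. -/
theorem distC_xor_codeword (r : (Fin m → Bool) → Bool) {e : (Fin m → Bool) → Bool} (he : IsElim1 m e) :
    distC m (fun v => xor (r v) (e v)) = distC m r := by
  refine le_antisymm ?_ ?_
  · refine le_distC fun Q hQ => ?_
    have h := distC_le (r := fun v => xor (r v) (e v)) (isElim1_xor hQ he)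
    rw [pdist_xor] at h
    have heq : (fun v => xor (xor (Q v) (e v)) (e v)) = Q := by
      funext v; cases Q v <;> cases e v <;> rfl
    rwa [heq] at h
  · refine le_distC fun Q hQ => ?_
    have h := distC_le (r := r) (isElim1_xor hQ he)
    rw [← pdist_xor] at h
    exact h

/-! ### The bracket shift -/

/-- **`BracketShift m`**: the mass bracket is invariant under adding a matrix whose rows are codewords. -/
theorem bracketShift (m : ℕ) : BracketShift m := by
  intro K0 D E _ hrows
  unfold bracket
  have h : ∀ u, distC m (fun v => xor (D u v) (E u v)) = distC m (D u) :=
    fun u => distC_xor_codeword (D u) (hrows u)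
  simp only [h]

/-! ### The light-deviation lemma -/

/-- Double counting: `Σ_{u : K0 u = b} pwt (D u) = Σ_v #{u : D u v ∧ K0 u = b}`. -/
theorem sum_pwt_eq_sum_cols (K0 : (Fin m → Bool) → Bool) (D : (Fin m → Bool) → (Fin m → Bool) → Bool)
    (b : Bool) :
    ∑ u ∈ univ.filter (fun u : Fin m → Bool => K0 u = b), pwt (D u) =
      ∑ v : Fin m → Bool, (univ.filter fun u : Fin m → Bool => D u v = true ∧ K0 u = b).card := by
  classical
  have hrow : ∀ u : Fin m → Bool, pwt (D u) = ∑ v : Fin m → Bool, if D u v = true then 1 else 0 := by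
    intro u; unfold pwt; rw [Finset.card_filter]
  have hcol : ∀ v : Fin m → Bool, (univ.filter fun u : Fin m → Bool => D u v = true ∧ K0 u = b).card =
      ∑ u ∈ univ.filter (fun u : Fin m → Bool => K0 u = b), if D u v = true then 1 else 0 := by
    intro v
    rw [Finset.sum_filter, Finset.card_filter]
    refine Finset.sum_congr rfl fun u _ => ?_
    by_cases h1 : D u v = true <;> by_cases h2 : K0 u = b <;> simp [h1, h2]
  simp_rw [hrow, hcol]
  exact Finset.sum_comm

/-- **`LightMass m`** (ROUND-12 §2.10 (xi-l)): support concentration at `K0` ⇒ every row-light column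
deviation has a non-negative mass bracket — the product beats every light deviation. -/
theorem lightMass (m : ℕ) : LightMass m := by
  classical
  intro K0 hSC D hcols hlight
  unfold bracket
  have hdist : ∀ u, distC m (D u) = pwt (D u) := fun u => distC_eq_pwt_of_light (hlight u)
  simp only [hdist]
  rw [← Nat.cast_sum, ← Nat.cast_sum, sum_pwt_eq_sum_cols K0 D true, sum_pwt_eq_sum_cols K0 D false,
    sub_nonneg, Nat.cast_le]
  exact sum_le_sum fun v _ => hSC (fun u => D u v) (hcols v)


/-! ### SC₁ is optimality (planner ask L26)

`|A ∩ Z(K0)| − |A ∖ Z(K0)| = failCount K0 − failCount (K0 ⊕ A)` (the weight-of-sum identity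
`wt (x + y) = wt x + wt y − 2·wt (x ∧ y)`, MacWilliams–Sloane ch. 1), and `K0 ⊕ A ∈ C_m`; so support
concentration at `K0` is EQUIVALENT to the optimality of `K0` — for every optimal codeword, symmetric or
not, at every `m`.  In particular the rungs `SC1Sym m`, `SC1Eight`, `SC1Fourteen`, `SC1Fifteen` hold, and the
SC₁ slack at `A` equals `failCount (K0 ⊕ A) − w(m,1)` (zero iff `K0 ⊕ A` is a second optimum). -/

/-- The weight-of-sum identity in `failCount` form:
`failCount (K0 ⊕ A) + |A ∖ Z(K0)|… = failCount K0 + |A ∩ supp K0|`, pointwise on the cube. -/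
theorem failCount_xor_add (K0 A : (Fin m → Bool) → Bool) :
    failCount (fun u => xor (K0 u) (A u)) +
        (univ.filter fun u : Fin m → Bool => A u = true ∧ K0 u = false).card =
      failCount K0 + (univ.filter fun u : Fin m → Bool => A u = true ∧ K0 u = true).card := by
  simp only [failCount, Finset.card_filter, ← Finset.sum_add_distrib]
  refine Finset.sum_congr rfl fun u _ => ?_
  cases K0 u <;> cases A u <;> rfl

/-- **SC₁ at every optimal codeword** (L26): `IsOpt1 m K0 → SC1At m K0`, no symmetry hypothesis. -/
theorem sc1At_of_isOpt1 {K0 : (Fin m → Bool) → Bool} (hK : IsOpt1 m K0) : SC1At m K0 := by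
  intro A hA
  have h1 := hK.2 _ (isElim1_xor hK.1 hA)
  have h2 := failCount_xor_add K0 A
  omega

/-- Conversely, support concentration at a codeword forces its optimality. -/
theorem isOpt1_of_sc1At {K0 : (Fin m → Bool) → Bool} (hK : IsElim1 m K0) (h : SC1At m K0) :
    IsOpt1 m K0 := by
  refine ⟨hK, fun X hX => ?_⟩
  have h1 := h _ (isElim1_xor hK hX)
  have h2 := failCount_xor_add K0 (fun u => xor (K0 u) (X u))
  have hX' : (fun u => xor (K0 u) (xor (K0 u) (X u))) = X := by
    funext u; cases K0 u <;> cases X u <;> rfl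
  rw [hX'] at h2
  omega

/-- `SC1At m K0 ↔ IsOpt1 m K0` on codewords. -/
theorem sc1At_iff_isOpt1 {K0 : (Fin m → Bool) → Bool} (hK : IsElim1 m K0) : SC1At m K0 ↔ IsOpt1 m K0 :=
  ⟨isOpt1_of_sc1At hK, sc1At_of_isOpt1⟩

/-- **`SC1Sym m` for every `m`.** -/
theorem sc1Sym (m : ℕ) : SC1Sym m := fun _ hK _ => sc1At_of_isOpt1 hK

/-- Rung `SC1Eight`. -/
theorem sc1Eight : SC1Eight := sc1Sym 8

/-- Rung `SC1Fourteen`. -/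
theorem sc1Fourteen : SC1Fourteen := sc1Sym 14

/-- Rung `SC1Fifteen`. -/
theorem sc1Fifteen : SC1Fifteen := sc1Sym 15

/-- `MassIneq m` therefore needs no separate SC₁ input: at every optimal symmetric `K0` the light-deviation
lemma applies outright. -/
theorem lightMass_of_isOpt1 {K0 : (Fin m → Bool) → Bool} (hK : IsOpt1 m K0)
    (D : (Fin m → Bool) → (Fin m → Bool) → Bool) (hcols : ColsInC m D) (hlight : RowLight m D) :
    0 ≤ bracket m K0 D :=
  lightMass m K0 (sc1At_of_isOpt1 hK) D hcols hlight

end MassInequality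

end Summit.QuantumAdvantage.AdviceFreeQNC0
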